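import Literature.Probability.LatticeModels.BackboneChainRuleTwo
import Literature.Probability.LatticeModels.SourcelessConnectivity
import Literature.Probability.LatticeModels.CrossingUniquenessPrelim
import HarnessLib

/-!
# A current with nearby sources rarely crosses a wide annulus (Aizenman–Duminil-Copin 2021, proof of Lemma 6.7, (6.11)–(6.12))

Topic `Literature/Probability/LatticeModels`. Theorems only: no definition and **no named fact is introduced**
(D-0026).

M. Aizenman, H. Duminil-Copin, Ann. of Math. **194** (2021) = arXiv:1912.07973, §6.2, proof of **Lemma 6.7**
(p. 25): "We bound the probability of `n_i` crossing `Ann(M,N)` by splitting `Ann(M,N)` in two annuli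
`Ann(M,R)` and `Ann(R,N)` with `R = √(MN)`, then estimating the probability that the backbone of `n_i` crosses
the inner annulus, and then the probability that the remaining current crosses the outer annulus. More
precisely, the chain rule for backbones [AizBarFer87] gives … (6.11) `P^{xy}[Γ(n_i) crosses Ann(M,R)] ≤
∑_{v ∈ ∂Λ_R} ⟨σ_{x_i}σ_v⟩⟨σ_vσ_{u_i}⟩/⟨σ_{x_i}σ_{u_i}⟩` … Then, observe that the remaining current `n_i ∖ Γ(n_i)`
is sourceless. Adding an additional sourceless current and using the switching lemma and Griffiths inequality
… gives (6.12) `P^{xy}[n_i ∖ Γ(n_i) crosses Ann(R,N)] ≤ ∑_{v ∈ ∂Λ_R, w ∈ ∂Λ_N} ⟨σ_vσ_w⟩²`. … When dealing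
with the probability of `n'_i` crossing `Ann(n,m)`, fix `r = √(nm)` and apply the same reasoning with the
annuli `Ann(n,r)` and `Ann(r,m)`."

This file proves these bounds on a finite simple graph, for couplings `K ≥ 0`, in un-normalised current-sum
form, for ONE current (the pairs are put together by `SplitEventFailure` and `RandomCurrentsMixingSplitBound`):

* `Current.tsum_offCross_mul_sq_le` — **(6.12), no geometry**: for finite vertex sets `T, S`,
  `(∑ 1{∂n={a}Δ{b}} w(n) 𝟙[n 𝟙_{used(Γ)ᶜ} connects T to S]) · Z[∅]² ≤ Z[{a}Δ{b}] · ∑_{s∈T,z∈S} Z[{s}Δ{z}]²`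
  (cylinder decomposition of the backbone explored from `a`, `BackboneChainRuleTwo`, and the depleted
  sourceless crossing bound `sourcelessCrossMass_mul_le_of_le`);
* `Current.tsum_event_mul_sq_le` — **(6.11) + (6.12)**: if an event `X` of currents with sources `{a,b}`
  forces, whenever the backbone misses `S`, the off part to connect `T` to `S`, then
  `(∑ 1{∂n={a}Δ{b}} w(n) 𝟙[X]) · Z[∅]² ≤ (∑_{u∈S} Z[{a}Δ{u}]Z[{u}Δ{b}]) · Z[∅] + Z[{a}Δ{b}] · ∑_{s∈T,z∈S} Z[{s}Δ{z}]²`,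
  i.e. `P^{ab}[X] ≤ ∑_{u∈S} ⟨σ_aσ_u⟩⟨σ_uσ_b⟩/⟨σ_aσ_b⟩ + ∑_{s∈T,z∈S} ⟨σ_sσ_z⟩²` (chain rule
  `tsum_backboneVisits_mul_le` for the first term); and `Current.tsum_sourceless_event_mul_le`, the sourceless
  analogue `P^∅[X] ≤ ∑_{s∈T,z∈S}⟨σ_sσ_z⟩²` when `X` forces `n` itself to connect `T` to `S`;
* the geometry, on a vertex type with a pseudo-metric whose distances to a centre `o` are integers changing
  by at most one along edges (the setting of `AnnulusCrossing`; spheres `S_ρ = {dist = ρ}`): discrete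
  intermediate values along open paths (`exists_dist_eq_of_walk_le/ge`), and the two "remaining current"
  lemmas — OUTWARD (`off_crossesOut_of_cluster_crosses`: backbone from `a ∈ Λ_M` missing `S_R`, `M < R ≤ N'`,
  and a cluster joining `{dist ≥ N'}` to `Λ_M` ⇒ the off part joins `S_{N'}` to `S_R`) and INWARD
  (`off_crossesIn_of_cluster_crosses`: backbone from `a ∉ Λ_r` missing `S_r`, `n₀ ≤ r`, and a cluster
  joining `{dist ≥ r}` to `Λ_{n₀}` ⇒ the off part joins `S_{n₀}` to `S_r`);
* the resulting bounds `Current.tsum_crossOut_mul_sq_le` (current `n_i`, sources in `Λ_M`, crossing of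
  `Ann(M,N')`: spheres `S_R` and `S_{N'} × S_R`), `Current.tsum_crossIn_mul_sq_le` (current `n'_i`, explored
  source outside `Λ_r`, crossing of `Ann(n₀, r)` inward: spheres `S_r` and `S_{n₀} × S_r`) and
  `Current.tsum_sourceless_cross_mul_le` (sourceless current joining `{dist ≥ N'}` to `Λ_M`: `S_{N'} × S_M`).

## References

* M. Aizenman, H. Duminil-Copin, Ann. of Math. 194 (2021), arXiv:1912.07973, §6.2, proof of Lemma 6.7, (6.11)
  and (6.12) (p. 25) [AizenmanDuminilCopinAnnals2021].
* M. Aizenman, Comm. Math. Phys. 86 (1982), §9 (the backbone and its cylinders) [AizenmanCMP1982] — through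
  `CurrentExploration*`, `BackboneChainRule*`.
-/

noncomputable section

open Finset Filter
open scoped symmDiff ENNReal

namespace Literature.Probability.LatticeModels

variable {V : Type*} [Fintype V] [DecidableEq V] {G : SimpleGraph V} [DecidableRel G.Adj]

namespace Current

variable {rk : G.edgeFinset → ℕ} {n : Current G} {Y : Finset V}

/-! ### The off part crossing: cylinder decomposition ((6.12), no geometry) -/

section OffPart

variable {K : G.edgeFinset → ℝ}
set_option maxHeartbeats 400000 in
open Classical in
/-- **The remaining current crossing bound, (6.12), current-sum form** (no geometry involved): for finite
vertex sets `T, S`,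
`(∑ 1{∂n={a}Δ{b}} w(n) 𝟙[n 𝟙_{used(Γ)ᶜ} connects T to S]) · Z[∅]² ≤ Z[{a}Δ{b}] · ∑_{s∈T} ∑_{z∈S} Z[{s}Δ{z}]²`,
i.e. `P^{ab}[n ∖ Γ(n) connects T to S] ≤ ∑_{s,z} ⟨σ_sσ_z⟩²`: partition by the final state `δ` of the
exploration (`tsum_mul_indicator_pos_eq_sum`), factor each cylinder as `patSum(δ) · (sourceless crossing mass
for the depleted couplings K off used(δ))` (`tsum_sources_inCyl_mul_eq`, `tsum_off_eq_tsum_koff`), bound the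
latter by `sourcelessCrossMass_mul_le_of_le` (switching + Griffiths for `K off D ≤ K`) and re-sum
`∑_δ patSum(δ) Z_{K off used(δ)}[∅] = Z[{a}Δ{b}]`.
[cite: AizenmanDuminilCopinAnnals2021, arXiv:1912.07973 §6.2, proof of Lemma 6.7, (6.12) (p. 25)] -/
theorem tsum_offCross_mul_sq_le (hK : ∀ e, 0 ≤ K e) (hrk : Function.Injective rk) (a b : V) (T S : Finset V) :
    (∑' n : Current G, (if n.sources = {a} ∆ {b} then n.eweight K else 0) *
        crossInd T S (onEdges (explore rk n {b} a).usedᶜ n)) * ecurrentSum K ∅ ^ 2 ≤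
      ecurrentSum K ({a} ∆ {b}) * ∑ s ∈ T, ∑ z ∈ S, ecurrentSum K ({s} ∆ {z}) ^ 2 := by
  -- insert `𝟙[(explore n).pos = b] = 1` on the support and partition by the final state
  have hins : ∀ n : Current G, (if n.sources = {a} ∆ {b} then n.eweight K else 0) *
      crossInd T S (onEdges (explore rk n {b} a).usedᶜ n) =
      (if n.sources = {a} ∆ {b} then n.eweight K else 0) * crossInd T S (onEdges (explore rk n {b} a).usedᶜ n) *
        (if (explore rk n {b} a).pos = b then 1 else 0) := by
    intro n
    by_cases hns : n.sources = {a} ∆ {b}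
    · rw [if_pos (explore_done_of_sources_eq hrk hns).2, mul_one]
    · rw [if_neg hns, zero_mul, zero_mul]
  rw [tsum_congr hins, tsum_mul_indicator_pos_eq_sum hrk _ a b]
  -- each cylinder: `patSum δ · sourcelessCrossMass (K off used δ) T S`
  have hcyl : ∀ δ ∈ finalStates rk {b} a b,
      ∑' n : Current G, (if n.sources = {a} ∆ {b} then n.eweight K else 0) *
        crossInd T S (onEdges (explore rk n {b} a).usedᶜ n) * (if InCyl δ n then 1 else 0) =
      patSum K δ * sourcelessCrossMass (koff K δ.used) T S := by
    intro δ hδ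
    obtain ⟨hpos, n₀, hδ'⟩ := mem_finalStates_iff.1 hδ
    have h := tsum_sources_inCyl_mul_eq hK hrk hδ' ({a} ∆ {b}) (crossInd T S)
    rw [hpos, symmDiff_self, Finset.bot_eq_empty] at h
    have hL : ∑' n : Current G, (if n.sources = {a} ∆ {b} then n.eweight K else 0) *
        crossInd T S (onEdges (explore rk n {b} a).usedᶜ n) * (if InCyl δ n then 1 else 0) =
        ∑' n : Current G, (if n.sources = {a} ∆ {b} ∧ InCyl δ n then n.eweight K else 0) *
          crossInd T S (onEdges δ.usedᶜ n) := by
      refine tsum_congr fun n => ?_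
      by_cases hc : InCyl δ n
      · have hex : explore rk n {b} a = δ := by rw [hδ']; exact ((explore_eq_iff_inCyl hrk).2 (hδ' ▸ hc))
        by_cases hns : n.sources = {a} ∆ {b}
        · rw [if_pos hns, if_pos hc, if_pos ⟨hns, hc⟩, mul_one, hex]
        · simp [hns]
      · simp [hc]
    rw [hL, h]
    congr 1
    unfold sourcelessCrossMass
    rw [tsum_off_eq_tsum_koff δ.used ∅ (crossInd T S)]
  rw [Finset.sum_congr rfl hcyl, Finset.sum_mul]
  -- bound each cylinder term with the depleted sourceless crossing bound
  have hbd : ∀ δ ∈ finalStates rk {b} a b, patSum K δ * sourcelessCrossMass (koff K δ.used) T S * ecurrentSum K ∅ ^ 2 ≤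
      patSum K δ * ecurrentSum (koff K δ.used) ∅ * ∑ s ∈ T, ∑ z ∈ S, ecurrentSum K ({s} ∆ {z}) ^ 2 := by
    intro δ _
    have hk0 : ecurrentSum (koff K δ.used) (∅ : Finset V) ≠ 0 := ecurrentSum_empty_ne_zero _
    have hktop : ecurrentSum (koff K δ.used) (∅ : Finset V) ≠ ∞ := ecurrentSum_ne_top (koff_nonneg hK _) ∅
    have h := sourcelessCrossMass_mul_le_of_le (koff_nonneg hK δ.used) (koff_le hK δ.used) T S
    -- `sCM · Zk[∅] · Z[∅]² ≤ (ΣΣ) · Zk[∅]²` ⇒ `sCM · Z[∅]² ≤ (ΣΣ) · Zk[∅]`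
    have h' : sourcelessCrossMass (koff K δ.used) T S * ecurrentSum K ∅ ^ 2 * ecurrentSum (koff K δ.used) ∅ ≤
        (∑ s ∈ T, ∑ z ∈ S, ecurrentSum K ({s} ∆ {z}) ^ 2) * ecurrentSum (koff K δ.used) ∅ * ecurrentSum (koff K δ.used) ∅ :=
      calc sourcelessCrossMass (koff K δ.used) T S * ecurrentSum K ∅ ^ 2 * ecurrentSum (koff K δ.used) ∅
          = sourcelessCrossMass (koff K δ.used) T S * ecurrentSum (koff K δ.used) ∅ * ecurrentSum K ∅ ^ 2 :=
            mul_right_comm _ _ _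
        _ ≤ (∑ s ∈ T, ∑ z ∈ S, ecurrentSum K ({s} ∆ {z}) ^ 2) * ecurrentSum (koff K δ.used) ∅ ^ 2 := h
        _ = (∑ s ∈ T, ∑ z ∈ S, ecurrentSum K ({s} ∆ {z}) ^ 2) * ecurrentSum (koff K δ.used) ∅ *
              ecurrentSum (koff K δ.used) ∅ := by rw [sq, mul_assoc]
    have h'' : sourcelessCrossMass (koff K δ.used) T S * ecurrentSum K ∅ ^ 2 ≤
        (∑ s ∈ T, ∑ z ∈ S, ecurrentSum K ({s} ∆ {z}) ^ 2) * ecurrentSum (koff K δ.used) ∅ :=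
      (ENNReal.mul_le_mul_iff_left hk0 hktop).1 h'
    calc patSum K δ * sourcelessCrossMass (koff K δ.used) T S * ecurrentSum K ∅ ^ 2
        = patSum K δ * (sourcelessCrossMass (koff K δ.used) T S * ecurrentSum K ∅ ^ 2) := mul_assoc _ _ _
      _ ≤ patSum K δ * ((∑ s ∈ T, ∑ z ∈ S, ecurrentSum K ({s} ∆ {z}) ^ 2) * ecurrentSum (koff K δ.used) ∅) :=
          mul_le_mul' le_rfl h''
      _ = patSum K δ * ecurrentSum (koff K δ.used) ∅ * ∑ s ∈ T, ∑ z ∈ S, ecurrentSum K ({s} ∆ {z}) ^ 2 := by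
          rw [mul_comm (∑ s ∈ T, ∑ z ∈ S, ecurrentSum K ({s} ∆ {z}) ^ 2), mul_assoc]
  refine (Finset.sum_le_sum hbd).trans ?_
  rw [← Finset.sum_mul]
  -- `∑_δ patSum δ · Zk[∅] = Z[{a}Δ{b}]`
  have htot : ∑ δ ∈ finalStates rk {b} a b, patSum K δ * ecurrentSum (koff K δ.used) ∅ = ecurrentSum K ({a} ∆ {b}) := by
    have h1 : ∀ δ ∈ finalStates rk {b} a b, patSum K δ * ecurrentSum (koff K δ.used) ∅ =
        ∑' n : Current G, (if n.sources = {a} ∆ {b} then n.eweight K else 0) * (if InCyl δ n then 1 else 0) := by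
      intro δ hδ
      rw [tsum_inCyl_of_mem_finalStates hK hrk hδ ({a} ∆ {b}), symmDiff_self, Finset.bot_eq_empty]
    rw [Finset.sum_congr rfl h1, ← tsum_mul_indicator_pos_eq_sum hrk _ a b]
    unfold ecurrentSum
    refine tsum_congr fun n => ?_
    by_cases hns : n.sources = {a} ∆ {b}
    · rw [if_pos hns, if_pos (explore_done_of_sources_eq hrk hns).2, mul_one]
    · rw [if_neg hns, zero_mul]
  rw [htot]

/-- **(6.11) + (6.12) for an abstract event.** If an event `X` of the currents with sources `{a} Δ {b}`
forces, whenever the backbone explored from `a` misses the vertex set `S`, the off part `n 𝟙_{used(Γ)ᶜ}` to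
connect `T` to `S`, then
`(∑ 1{∂n={a}Δ{b}} w(n) 𝟙[X]) · Z[∅]² ≤ (∑_{u ∈ S} Z[{a}Δ{u}] Z[{u}Δ{b}]) · Z[∅] + Z[{a}Δ{b}] · ∑_{s∈T,z∈S} Z[{s}Δ{z}]²`,
i.e. `P^{ab}[X] ≤ ∑_{u ∈ S} ⟨σ_aσ_u⟩⟨σ_uσ_b⟩/⟨σ_aσ_b⟩ + ∑_{s ∈ T, z ∈ S} ⟨σ_sσ_z⟩²` (the chain rule
`tsum_backboneVisits_mul_le` and `tsum_offCross_mul_sq_le`).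
[cite: AizenmanDuminilCopinAnnals2021, arXiv:1912.07973 §6.2, proof of Lemma 6.7, (6.11)–(6.12) (p. 25)] -/
theorem tsum_event_mul_sq_le (hK : ∀ e, 0 ≤ K e) (hrk : Function.Injective rk) (a b : V) (T S : Finset V)
    (X : Current G → Prop) [DecidablePred X]
    (himp : ∀ n : Current G, n.sources = {a} ∆ {b} → X n → ¬((explore rk n {b} a).vis ∩ S).Nonempty →
      crossInd T S (onEdges (explore rk n {b} a).usedᶜ n) = 1) :
    (∑' n : Current G, (if n.sources = {a} ∆ {b} then n.eweight K else 0) * (if X n then 1 else 0)) *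
        ecurrentSum K ∅ ^ 2 ≤
      (∑ u ∈ S, ecurrentSum K ({a} ∆ {u}) * ecurrentSum K ({u} ∆ {b})) * ecurrentSum K ∅ +
        ecurrentSum K ({a} ∆ {b}) * ∑ s ∈ T, ∑ z ∈ S, ecurrentSum K ({s} ∆ {z}) ^ 2 := by
  classical
  -- pointwise split on the support: `𝟙[X] ≤ 𝟙[vis ∩ S ≠ ∅] + 𝟙[off part connects T to S]`
  have hpt : ∀ n : Current G, n.sources = {a} ∆ {b} →
      (if X n then (1 : ℝ≥0∞) else 0) ≤ (if ((explore rk n {b} a).vis ∩ S).Nonempty then 1 else 0) +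
        crossInd T S (onEdges (explore rk n {b} a).usedᶜ n) := by
    intro n hns
    by_cases hX : X n
    · rw [if_pos hX]
      by_cases hv : ((explore rk n {b} a).vis ∩ S).Nonempty
      · rw [if_pos hv]; exact le_self_add
      · rw [if_neg hv, zero_add, himp n hns hX hv]
    · rw [if_neg hX]; exact zero_le
  have hT1 := tsum_backboneVisits_mul_le hK hrk {b} a b S
  have hT2 := tsum_offCross_mul_sq_le hK hrk a b T S
  calc (∑' n : Current G, (if n.sources = {a} ∆ {b} then n.eweight K else 0) * (if X n then 1 else 0)) * ecurrentSum K ∅ ^ 2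
      ≤ (∑' n : Current G, ((if n.sources = {a} ∆ {b} then n.eweight K else 0) *
            (if ((explore rk n {b} a).vis ∩ S).Nonempty then 1 else 0) +
          (if n.sources = {a} ∆ {b} then n.eweight K else 0) * crossInd T S (onEdges (explore rk n {b} a).usedᶜ n))) *
          ecurrentSum K ∅ ^ 2 := by
        refine mul_le_mul' (ENNReal.tsum_le_tsum fun n => ?_) le_rfl
        by_cases hns : n.sources = {a} ∆ {b}
        · rw [← mul_add]; exact mul_le_mul' le_rfl (hpt n hns)
        · simp [hns]
    _ = (∑' n : Current G, (if n.sources = {a} ∆ {b} then n.eweight K else 0) *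
            (if ((explore rk n {b} a).vis ∩ S).Nonempty then 1 else 0)) * ecurrentSum K ∅ * ecurrentSum K ∅ +
        (∑' n : Current G, (if n.sources = {a} ∆ {b} then n.eweight K else 0) *
          crossInd T S (onEdges (explore rk n {b} a).usedᶜ n)) * ecurrentSum K ∅ ^ 2 := by
        rw [ENNReal.tsum_add, add_mul, sq, mul_assoc]
    _ ≤ (∑ u ∈ S, ecurrentSum K ({a} ∆ {u}) * ecurrentSum K ({u} ∆ {b})) * ecurrentSum K ∅ +
        ecurrentSum K ({a} ∆ {b}) * ∑ s ∈ T, ∑ z ∈ S, ecurrentSum K ({s} ∆ {z}) ^ 2 :=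
        add_le_add (mul_le_mul' hT1 le_rfl) hT2

/-- **The sourceless analogue**: if an event `X` of sourceless currents forces `n` to connect `T` to `S`, then
`(∑ 1{∂n=∅} w(n) 𝟙[X]) · Z[∅] ≤ ∑_{s∈T,z∈S} Z[{s}Δ{z}]²`, i.e. `P^∅[X] ≤ ∑_{s,z} ⟨σ_sσ_z⟩²`
(`sourcelessCrossMass_mul_le`; "the case `t < i ≤ s` being even simpler since there are no sources").
[cite: AizenmanDuminilCopinAnnals2021, arXiv:1912.07973 §6.2, proof of Lemma 6.7 (p. 25)] -/
theorem tsum_sourceless_event_mul_le (hK : ∀ e, 0 ≤ K e) (T S : Finset V) (X : Current G → Prop) [DecidablePred X]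
    (himp : ∀ n : Current G, n.sources = ∅ → X n → crossInd T S n = 1) :
    (∑' n : Current G, (if n.sources = ∅ then n.eweight K else 0) * (if X n then 1 else 0)) * ecurrentSum K ∅ ≤
      ∑ s ∈ T, ∑ z ∈ S, ecurrentSum K ({s} ∆ {z}) ^ 2 := by
  classical
  refine le_trans (mul_le_mul' (ENNReal.tsum_le_tsum fun n => ?_) le_rfl) (sourcelessCrossMass_mul_le hK T S)
  by_cases hns : n.sources = ∅
  · refine mul_le_mul' le_rfl ?_
    by_cases hX : X n
    · rw [if_pos hX, himp n hns hX]
    · rw [if_neg hX]; exact zero_le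
  · simp [hns]

end OffPart

/-! ### Geometry: discrete intermediate values and the remaining current -/

section Geometry

variable [PseudoMetricSpace V] {o : V}

omit [Fintype V] [DecidableEq V] [DecidableRel G.Adj] in
/-- **Discrete intermediate values along an open path, going down**: in a subgraph `H` of `G`, a walk from
`c` with `dist c ≥ k` to `t` with `dist t ≤ k` passes through a vertex at distance exactly `k` (integer
distances changing by at most one along the edges of `G`). [folklore] -/
theorem exists_dist_eq_of_walk_ge {H : SimpleGraph V} (hH : ∀ v w, H.Adj v w → G.Adj v w)
    (hstep : ∀ v w, G.Adj v w → dist o w ≤ dist o v + 1) (hint : ∀ v, ∃ k : ℕ, dist o v = k) (k : ℕ) :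
    ∀ {c t : V} (_ : H.Walk c t), (k : ℝ) ≤ dist o c → dist o t ≤ k →
      ∃ p, dist o p = k ∧ H.Reachable c p ∧ H.Reachable p t := by
  classical
  choose dn hdn using hint
  intro c t q
  induction q with
  | nil =>
    intro hc ht
    exact ⟨_, le_antisymm ht hc, SimpleGraph.Reachable.refl _, SimpleGraph.Reachable.refl _⟩
  | @cons c c' t hadj q ih =>
    intro hc ht
    by_cases hck : dist o c ≤ k
    · exact ⟨c, le_antisymm hck hc, SimpleGraph.Reachable.refl _, ⟨SimpleGraph.Walk.cons hadj q⟩⟩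
    · push Not at hck
      have h1 : dist o c ≤ dist o c' + 1 := hstep c' c (hH c c' hadj).symm
      have hc' : (k : ℝ) ≤ dist o c' := by
        rw [hdn] at hck h1 ⊢; rw [hdn] at h1
        have h2 : k < dn c := by exact_mod_cast hck
        have h3 : dn c ≤ dn c' + 1 := by exact_mod_cast h1
        exact_mod_cast (show k ≤ dn c' by omega)
      obtain ⟨p, hp, hcp, hpt⟩ := ih hc' ht
      exact ⟨p, hp, hadj.reachable.trans hcp, hpt⟩

omit [Fintype V] [DecidableEq V] [DecidableRel G.Adj] in
/-- **Discrete intermediate values along an open path, going up**: a walk from `c` with `dist c ≤ k` to `t`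
with `dist t ≥ k` passes through a vertex at distance exactly `k`. [folklore] -/
theorem exists_dist_eq_of_walk_le {H : SimpleGraph V} (hH : ∀ v w, H.Adj v w → G.Adj v w)
    (hstep : ∀ v w, G.Adj v w → dist o w ≤ dist o v + 1) (hint : ∀ v, ∃ k : ℕ, dist o v = k) (k : ℕ) :
    ∀ {c t : V} (_ : H.Walk c t), dist o c ≤ k → (k : ℝ) ≤ dist o t →
      ∃ p, dist o p = k ∧ H.Reachable c p ∧ H.Reachable p t := by
  classical
  choose dn hdn using hint
  intro c t q
  induction q with
  | nil =>
    intro hc ht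
    exact ⟨_, le_antisymm hc ht, SimpleGraph.Reachable.refl _, SimpleGraph.Reachable.refl _⟩
  | @cons c c' t hadj q ih =>
    intro hc ht
    by_cases hck : (k : ℝ) ≤ dist o c
    · exact ⟨c, le_antisymm hc hck, SimpleGraph.Reachable.refl _, ⟨SimpleGraph.Walk.cons hadj q⟩⟩
    · push Not at hck
      have h1 : dist o c' ≤ dist o c + 1 := hstep c c' (hH c c' hadj)
      have hc' : dist o c' ≤ k := by
        rw [hdn] at hck h1 ⊢; rw [hdn] at h1
        have h2 : dn c < k := by exact_mod_cast hck
        have h3 : dn c' ≤ dn c + 1 := by exact_mod_cast h1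
        exact_mod_cast (show dn c' ≤ k by omega)
      obtain ⟨p, hp, hcp, hpt⟩ := ih hc' ht
      exact ⟨p, hp, hadj.reachable.trans hcp, hpt⟩

/-- **No visit to the sphere keeps the walk strictly inside**: if the walk from `a` (`dist a ≤ M < R`) is never
exactly at distance `R` from the centre, all its positions are at distance `< R` (`exists_pos_dist_eq_of_le`).
[folklore] -/
theorem dist_pos_lt_of_no_sphere_visit (hstep : ∀ v w, G.Adj v w → dist o w ≤ dist o v + 1)
    (hint : ∀ v, ∃ k : ℕ, dist o v = k) (a : V) {M R : ℕ} (hMR : M < R) (ha : dist o a ≤ M)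
    (hno : ∀ t, dist o (exploreAt rk n Y a t).pos ≠ R) (t : ℕ) : dist o (exploreAt rk n Y a t).pos < R := by
  by_contra hge
  push Not at hge
  have haR : dist o a ≤ (R : ℝ) := ha.trans (by exact_mod_cast hMR.le)
  obtain ⟨t', -, ht'⟩ := exists_pos_dist_eq_of_le (rk := rk) (n := n) (Y := Y) hstep hint a haR hge
  exact hno t' ht'

/-- **No visit to the sphere keeps the walk strictly outside**: if the walk from `a` (`dist a > r`) is never
exactly at distance `r`, all its positions are at distance `> r` (`exists_pos_dist_eq_of_ge`). [folklore] -/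
theorem lt_dist_pos_of_no_sphere_visit (hstep : ∀ v w, G.Adj v w → dist o w ≤ dist o v + 1)
    (hint : ∀ v, ∃ k : ℕ, dist o v = k) (a : V) {r : ℕ} (ha : (r : ℝ) < dist o a)
    (hno : ∀ t, dist o (exploreAt rk n Y a t).pos ≠ r) (t : ℕ) : (r : ℝ) < dist o (exploreAt rk n Y a t).pos := by
  by_contra hle
  push Not at hle
  have h0 : (r : ℝ) ≤ dist o (exploreAt rk n Y a 0).pos := by rw [exploreAt_zero]; exact ha.le
  obtain ⟨t', -, -, ht'⟩ := exists_pos_dist_eq_of_ge (rk := rk) (n := n) (Y := Y) hstep hint a (Nat.zero_le t) h0 hle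
  exact hno t' ht'

/-- **The remaining current does the outward crossing.** If the backbone explored from `a`
(`dist a ≤ M < R ≤ N'`) is never on the sphere `S_R`, and a cluster of `n` joins a site at distance `≥ N'`
to a site at distance `≤ M`, then the off part `n 𝟙_{used(Γ)ᶜ}` joins a site of `S_{N'}` to a site of
`S_R`: all visited sites are at distance `< R`; follow the joining path from its last passage on `S_{N'}` down
to its first arrival on `S_R` — the sites before the arrival are at distance `≥ R`, hence unvisited, so these
bonds are unused and carried by the off part (`adj_off_add_of_adj_of_avoid`).
[cite: AizenmanDuminilCopinAnnals2021, arXiv:1912.07973 §6.2, proof of Lemma 6.7 ("the remaining current n_i ∖ Γ(n_i) … crosses the outer annulus", p. 25)] -/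
theorem off_crossesOut_of_cluster_crosses (hstep : ∀ v w, G.Adj v w → dist o w ≤ dist o v + 1)
    (hint : ∀ v, ∃ k : ℕ, dist o v = k) (a : V) {M R N' : ℕ} (hMR : M < R) (hRN : R ≤ N') (ha : dist o a ≤ M)
    (hno : ∀ t, dist o (exploreAt rk n Y a t).pos ≠ R) {s v : V} (hs : (N' : ℝ) ≤ dist o s)
    (hvM : dist o v ≤ M) (hv : v ∈ n.cluster s) :
    ∃ s', dist o s' = N' ∧ ∃ z, dist o z = R ∧ z ∈ (onEdges (explore rk n Y a).usedᶜ n).cluster s' := by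
  classical
  choose dn hdn using hint
  have hint' : ∀ v, ∃ k : ℕ, dist o v = k := fun w => ⟨dn w, hdn w⟩
  have hvis : ∀ u ∈ (explore rk n Y a).vis, dn u < R := fun u hu => by
    rw [explore_eq_exploreAt] at hu
    obtain ⟨j, -, hj⟩ := (mem_vis_exploreAt_iff a _).1 hu
    have h := dist_pos_lt_of_no_sphere_visit hstep hint' a hMR ha hno j
    rw [hj, hdn] at h; exact_mod_cast h
  have hstep' : ∀ v w, G.Adj v w → dn w + 1 ≥ dn v := by
    intro v w h
    have h2 := hstep w v h.symm
    rw [hdn, hdn] at h2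
    exact_mod_cast h2
  set m : Current G := onEdges (explore rk n Y a).usedᶜ n with hm
  -- from a site at distance `≥ R` in the off cluster of `s'`, walk towards a site at distance `< R`
  have key : ∀ (s' c t : V) (_ : (Percolation.openGraph n.traced).Walk c t), R ≤ dn c → c ∈ m.cluster s' →
      dn t < R → ∃ z, dn z = R ∧ z ∈ m.cluster s' := by
    intro s' c t q
    induction q with
    | nil => intro hc _ ht; exact absurd ht (not_lt.2 hc)
    | @cons c c' t hadj q ih =>
      intro hc hcm ht
      by_cases hc' : R ≤ dn c'
      · have hcv : c ∉ (explore rk n Y a).vis := fun h => absurd (hvis c h) (not_lt.2 hc)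
        have hc'v : c' ∉ (explore rk n Y a).vis := fun h => absurd (hvis c' h) (not_lt.2 hc')
        have hadj0 : (Percolation.openGraph (n + 0).traced).Adj c c' := by rw [add_zero]; exact hadj
        have hadjm : (Percolation.openGraph m.traced).Adj c c' := by
          have h := adj_off_add_of_adj_of_avoid (rk := rk) (Y := Y) a 0 hadj0 hcv hc'v
          rw [add_zero] at h
          exact h
        exact ih hc' (mem_cluster_of_adj hcm hadjm) ht
      · push Not at hc'
        have h1 := hstep' c c' (adj_of_adj_traced hadj)
        exact ⟨c, by omega, hcm⟩
  -- the last passage of the joining path on `S_{N'}`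
  rw [mem_cluster_iff] at hv
  obtain ⟨p⟩ := hv
  have hvN : dist o v ≤ N' := hvM.trans (by exact_mod_cast (hMR.le.trans hRN))
  obtain ⟨s', hs', -, hs'v⟩ := exists_dist_eq_of_walk_ge (H := Percolation.openGraph n.traced)
    (fun _ _ h => adj_of_adj_traced h) hstep hint' N' p hs hvN
  obtain ⟨q⟩ := hs'v
  have hsR : R ≤ dn s' := by
    have h := hs'; rw [hdn] at h
    have : dn s' = N' := by exact_mod_cast h
    omega
  have hvR : dn v < R := by
    rw [hdn] at hvM
    have : dn v ≤ M := by exact_mod_cast hvM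
    omega
  obtain ⟨z, hz, hzc⟩ := key s' s' v q hsR (mem_cluster_self m s') hvR
  exact ⟨s', hs', z, by rw [hdn, hz], hzc⟩

/-- **The remaining current does the inward crossing.** If the backbone explored from `a` (`dist a > r`) is
never on the sphere `S_r`, `n₀ ≤ r`, and a cluster of `n` joins a site at distance `≥ r` to a site at distance
`≤ n₀`, then the off part joins a site of `S_{n₀}` to a site of `S_r`: all visited sites are at distance
`> r`; follow the joining path from its last passage on `S_{n₀}` up to its first arrival on `S_r`.
[cite: AizenmanDuminilCopinAnnals2021, arXiv:1912.07973 §6.2, proof of Lemma 6.7 ("When dealing with the probability of n'_i crossing Ann(n,m), fix r = √(nm) and apply the same reasoning", p. 25)] -/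
theorem off_crossesIn_of_cluster_crosses (hstep : ∀ v w, G.Adj v w → dist o w ≤ dist o v + 1)
    (hint : ∀ v, ∃ k : ℕ, dist o v = k) (a : V) {n₀ r : ℕ} (hnr : n₀ ≤ r) (ha : (r : ℝ) < dist o a)
    (hno : ∀ t, dist o (exploreAt rk n Y a t).pos ≠ r) {s v : V} (hs : (r : ℝ) ≤ dist o s)
    (hvn : dist o v ≤ n₀) (hv : v ∈ n.cluster s) :
    ∃ s', dist o s' = n₀ ∧ ∃ z, dist o z = r ∧ z ∈ (onEdges (explore rk n Y a).usedᶜ n).cluster s' := by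
  classical
  choose dn hdn using hint
  have hint' : ∀ v, ∃ k : ℕ, dist o v = k := fun w => ⟨dn w, hdn w⟩
  have hvis : ∀ u ∈ (explore rk n Y a).vis, r < dn u := fun u hu => by
    rw [explore_eq_exploreAt] at hu
    obtain ⟨j, -, hj⟩ := (mem_vis_exploreAt_iff a _).1 hu
    have h := lt_dist_pos_of_no_sphere_visit hstep hint' a ha hno j
    rw [hj, hdn] at h; exact_mod_cast h
  have hstep' : ∀ v w, G.Adj v w → dn w ≤ dn v + 1 := by
    intro v w h
    have h2 := hstep v w h
    rw [hdn, hdn] at h2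
    exact_mod_cast h2
  set m : Current G := onEdges (explore rk n Y a).usedᶜ n with hm
  -- from a site at distance `≤ r` in the off cluster of `s'`, walk towards a site at distance `≥ r`
  have key : ∀ (s' c t : V) (_ : (Percolation.openGraph n.traced).Walk c t), dn c ≤ r → c ∈ m.cluster s' →
      r ≤ dn t → ∃ z, dn z = r ∧ z ∈ m.cluster s' := by
    intro s' c t q
    induction q with
    | nil => intro hc hcm ht; exact ⟨_, le_antisymm hc ht, hcm⟩
    | @cons c c' t hadj q ih =>
      intro hc hcm ht
      by_cases hc' : dn c' ≤ r
      · have hcv : c ∉ (explore rk n Y a).vis := fun h => absurd (hvis c h) (not_lt.2 hc)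
        have hc'v : c' ∉ (explore rk n Y a).vis := fun h => absurd (hvis c' h) (not_lt.2 hc')
        have hadj0 : (Percolation.openGraph (n + 0).traced).Adj c c' := by rw [add_zero]; exact hadj
        have hadjm : (Percolation.openGraph m.traced).Adj c c' := by
          have h := adj_off_add_of_adj_of_avoid (rk := rk) (Y := Y) a 0 hadj0 hcv hc'v
          rw [add_zero] at h
          exact h
        exact ih hc' (mem_cluster_of_adj hcm hadjm) ht
      · push Not at hc'
        have h1 := hstep' c c' (adj_of_adj_traced hadj)
        exact ⟨c, by omega, hcm⟩
  -- the joining path read from `v`: its last passage on `S_{n₀}`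
  have hv' : s ∈ n.cluster v := by rw [mem_cluster_iff] at hv ⊢; exact hv.symm
  rw [mem_cluster_iff] at hv'
  obtain ⟨p⟩ := hv'
  have hsn : (n₀ : ℝ) ≤ dist o s := le_trans (by exact_mod_cast hnr) hs
  obtain ⟨s', hs', -, hs's⟩ := exists_dist_eq_of_walk_le (H := Percolation.openGraph n.traced)
    (fun _ _ h => adj_of_adj_traced h) hstep hint' n₀ p hvn hsn
  obtain ⟨q⟩ := hs's
  have hs'r : dn s' ≤ r := by
    have h := hs'; rw [hdn] at h
    have : dn s' = n₀ := by exact_mod_cast h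
    omega
  have hsr : r ≤ dn s := by rw [hdn] at hs; exact_mod_cast hs
  obtain ⟨z, hz, hzc⟩ := key s' s' s q hs'r (mem_cluster_self m s') hsr
  exact ⟨s', hs', z, by rw [hdn, hz], hzc⟩

omit [DecidableEq V] in
/-- **A sourceless (or any) current joining `{dist ≥ N'}` to `Λ_M` joins `S_{N'}` to `S_M`** (`M ≤ N'`; two
applications of the discrete intermediate value property). [folklore] -/
theorem crosses_spheres_of_cluster_crosses (hstep : ∀ v w, G.Adj v w → dist o w ≤ dist o v + 1)
    (hint : ∀ v, ∃ k : ℕ, dist o v = k) {M N' : ℕ} (hMN : M ≤ N') {s v : V} (hs : (N' : ℝ) ≤ dist o s)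
    (hvM : dist o v ≤ M) (hv : v ∈ n.cluster s) :
    ∃ s', dist o s' = N' ∧ ∃ z, dist o z = M ∧ z ∈ n.cluster s' := by
  rw [mem_cluster_iff] at hv
  obtain ⟨p⟩ := hv
  have hvN : dist o v ≤ N' := hvM.trans (by exact_mod_cast hMN)
  obtain ⟨s', hs', -, hs'v⟩ := exists_dist_eq_of_walk_ge (H := Percolation.openGraph n.traced)
    (fun _ _ h => adj_of_adj_traced h) hstep hint N' p hs hvN
  obtain ⟨q⟩ := hs'v
  have hs'M : (M : ℝ) ≤ dist o s' := by rw [hs']; exact_mod_cast hMN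
  obtain ⟨z, hz, hs'z, -⟩ := exists_dist_eq_of_walk_ge (H := Percolation.openGraph n.traced)
    (fun _ _ h => adj_of_adj_traced h) hstep hint M q hs'M hvM
  exact ⟨s', hs', z, hz, mem_cluster_iff.2 hs'z⟩

end Geometry

/-! ### The bounds on spheres -/

section Bound

variable {K : G.edgeFinset → ℝ} [PseudoMetricSpace V] {o : V}

open Classical in
/-- **Aizenman–Duminil-Copin 2021, (6.11) + (6.12): the current `n_i` (sources in `Λ_M`) crossing `Ann(M, N')`.**
For `K ≥ 0`, an injective ranking of the bonds, integer distances to the centre `o` changing by at most one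
along edges, radii `M < R ≤ N'`, the explored source `a ∈ Λ_M(o)` and the other source `b` arbitrary:
`(∑ 1{∂n={a}Δ{b}} w(n) 𝟙[∃ s v, dist s ≥ N', dist v ≤ M, v ∈ C_n(s)]) · Z[∅]²`
`≤ (∑_{u ∈ S_R} Z[{a}Δ{u}] Z[{u}Δ{b}]) · Z[∅] + Z[{a}Δ{b}] · ∑_{s ∈ S_{N'}} ∑_{z ∈ S_R} Z[{s}Δ{z}]²`,
i.e. `P^{ab}[n connects Λ_{N'-1}ᶜ to Λ_M] ≤ ∑_{u ∈ ∂Λ_R} ⟨σ_aσ_u⟩⟨σ_uσ_b⟩/⟨σ_aσ_b⟩ + ∑_{s ∈ ∂Λ_{N'}, z ∈ ∂Λ_R} ⟨σ_sσ_z⟩²`.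
[cite: AizenmanDuminilCopinAnnals2021, arXiv:1912.07973 §6.2, proof of Lemma 6.7, (6.11)–(6.12) (p. 25)] -/
theorem tsum_crossOut_mul_sq_le (hK : ∀ e, 0 ≤ K e) (hrk : Function.Injective rk)
    (hstep : ∀ v w, G.Adj v w → dist o w ≤ dist o v + 1) (hint : ∀ v, ∃ k : ℕ, dist o v = k)
    {M R N' : ℕ} (hMR : M < R) (hRN : R ≤ N') {a : V} (b : V) (ha : dist o a ≤ M) :
    (∑' n : Current G, (if n.sources = {a} ∆ {b} then n.eweight K else 0) *
        (if ∃ s, (N' : ℝ) ≤ dist o s ∧ ∃ v, dist o v ≤ M ∧ v ∈ n.cluster s then 1 else 0)) * ecurrentSum K ∅ ^ 2 ≤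
      (∑ u ∈ univ.filter (fun u => dist o u = R), ecurrentSum K ({a} ∆ {u}) * ecurrentSum K ({u} ∆ {b})) *
          ecurrentSum K ∅ +
      ecurrentSum K ({a} ∆ {b}) *
        ∑ s ∈ univ.filter (fun s => dist o s = N'), ∑ z ∈ univ.filter (fun z => dist o z = R),
          ecurrentSum K ({s} ∆ {z}) ^ 2 := by
  refine tsum_event_mul_sq_le hK hrk a b _ _ _ fun n _ hX hv => ?_
  -- no visit to `S_R`
  have hno : ∀ t, dist o (exploreAt rk n {b} a t).pos ≠ R := by
    intro t ht
    refine hv ⟨(exploreAt rk n {b} a t).pos, Finset.mem_inter.2 ⟨pos_exploreAt_mem_vis_explore' a t, ?_⟩⟩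
    rw [Finset.mem_filter]; exact ⟨Finset.mem_univ _, ht⟩
  obtain ⟨s, hs, v, hvM, hvc⟩ := hX
  obtain ⟨s', hs', z, hz, hzc⟩ := off_crossesOut_of_cluster_crosses hstep hint a hMR hRN ha hno hs hvM hvc
  unfold crossInd
  rw [if_pos]
  exact ⟨s', by rw [Finset.mem_filter]; exact ⟨Finset.mem_univ _, hs'⟩, z,
    by rw [Finset.mem_filter]; exact ⟨Finset.mem_univ _, hz⟩, hzc⟩

open Classical in
/-- **Aizenman–Duminil-Copin 2021, (6.11) + (6.12): the current `n'_i` (explored source outside `Λ_r`) crossing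
`Ann(n₀, r)` inwards.** For radii `n₀ ≤ r`, the explored source `a` with `dist a > r` and `b` arbitrary:
`(∑ 1{∂n={a}Δ{b}} w(n) 𝟙[∃ s v, dist s ≥ r, dist v ≤ n₀, v ∈ C_n(s)]) · Z[∅]²`
`≤ (∑_{u ∈ S_r} Z[{a}Δ{u}] Z[{u}Δ{b}]) · Z[∅] + Z[{a}Δ{b}] · ∑_{s ∈ S_{n₀}} ∑_{z ∈ S_r} Z[{s}Δ{z}]²`,
i.e. `P^{ab}[n connects Λ_{r-1}ᶜ to Λ_{n₀}] ≤ ∑_{u ∈ ∂Λ_r} ⟨σ_aσ_u⟩⟨σ_uσ_b⟩/⟨σ_aσ_b⟩ + ∑_{s ∈ ∂Λ_{n₀}, z ∈ ∂Λ_r} ⟨σ_sσ_z⟩²`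
(printed for `n'_i` with sources `u_i ∈ Ann(m,M)`, `y_i ∉ Λ_N` and the annuli `Ann(n,r)`, `Ann(r,m)`).
[cite: AizenmanDuminilCopinAnnals2021, arXiv:1912.07973 §6.2, proof of Lemma 6.7, (6.11)–(6.12) and "fix r = √(nm) and apply the same reasoning" (p. 25)] -/
theorem tsum_crossIn_mul_sq_le (hK : ∀ e, 0 ≤ K e) (hrk : Function.Injective rk)
    (hstep : ∀ v w, G.Adj v w → dist o w ≤ dist o v + 1) (hint : ∀ v, ∃ k : ℕ, dist o v = k)
    {n₀ r : ℕ} (hnr : n₀ ≤ r) {a : V} (b : V) (ha : (r : ℝ) < dist o a) :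
    (∑' n : Current G, (if n.sources = {a} ∆ {b} then n.eweight K else 0) *
        (if ∃ s, (r : ℝ) ≤ dist o s ∧ ∃ v, dist o v ≤ n₀ ∧ v ∈ n.cluster s then 1 else 0)) * ecurrentSum K ∅ ^ 2 ≤
      (∑ u ∈ univ.filter (fun u => dist o u = r), ecurrentSum K ({a} ∆ {u}) * ecurrentSum K ({u} ∆ {b})) *
          ecurrentSum K ∅ +
      ecurrentSum K ({a} ∆ {b}) *
        ∑ s ∈ univ.filter (fun s => dist o s = n₀), ∑ z ∈ univ.filter (fun z => dist o z = r),
          ecurrentSum K ({s} ∆ {z}) ^ 2 := by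
  refine tsum_event_mul_sq_le hK hrk a b _ _ _ fun n _ hX hv => ?_
  -- no visit to `S_r`
  have hno : ∀ t, dist o (exploreAt rk n {b} a t).pos ≠ r := by
    intro t ht
    refine hv ⟨(exploreAt rk n {b} a t).pos, Finset.mem_inter.2 ⟨pos_exploreAt_mem_vis_explore' a t, ?_⟩⟩
    rw [Finset.mem_filter]; exact ⟨Finset.mem_univ _, ht⟩
  obtain ⟨s, hs, v, hvn, hvc⟩ := hX
  obtain ⟨s', hs', z, hz, hzc⟩ := off_crossesIn_of_cluster_crosses hstep hint a hnr ha hno hs hvn hvc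
  unfold crossInd
  rw [if_pos]
  exact ⟨s', by rw [Finset.mem_filter]; exact ⟨Finset.mem_univ _, hs'⟩, z,
    by rw [Finset.mem_filter]; exact ⟨Finset.mem_univ _, hz⟩, hzc⟩

open Classical in
/-- **A sourceless current crossing `Ann(M, N')`** (`M ≤ N'`):
`(∑ 1{∂n=∅} w(n) 𝟙[∃ s v, dist s ≥ N', dist v ≤ M, v ∈ C_n(s)]) · Z[∅] ≤ ∑_{s ∈ S_{N'}} ∑_{z ∈ S_M} Z[{s}Δ{z}]²`,
i.e. `P^∅[n connects Λ_{N'-1}ᶜ to Λ_M] ≤ ∑_{s ∈ ∂Λ_{N'}, z ∈ ∂Λ_M} ⟨σ_sσ_z⟩²` ("the case `t < i ≤ s` being even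
simpler since there are no sources"). [cite: AizenmanDuminilCopinAnnals2021, arXiv:1912.07973 §6.2, proof of Lemma 6.7 (p. 25)] -/
theorem tsum_sourceless_cross_mul_le (hK : ∀ e, 0 ≤ K e)
    (hstep : ∀ v w, G.Adj v w → dist o w ≤ dist o v + 1) (hint : ∀ v, ∃ k : ℕ, dist o v = k)
    {M N' : ℕ} (hMN : M ≤ N') :
    (∑' n : Current G, (if n.sources = ∅ then n.eweight K else 0) *
        (if ∃ s, (N' : ℝ) ≤ dist o s ∧ ∃ v, dist o v ≤ M ∧ v ∈ n.cluster s then 1 else 0)) * ecurrentSum K ∅ ≤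
      ∑ s ∈ univ.filter (fun s => dist o s = N'), ∑ z ∈ univ.filter (fun z => dist o z = M),
        ecurrentSum K ({s} ∆ {z}) ^ 2 := by
  refine tsum_sourceless_event_mul_le hK _ _ _ fun n _ hX => ?_
  obtain ⟨s, hs, v, hvM, hvc⟩ := hX
  obtain ⟨s', hs', z, hz, hzc⟩ := crosses_spheres_of_cluster_crosses hstep hint hMN hs hvM hvc
  unfold crossInd
  rw [if_pos]
  exact ⟨s', by rw [Finset.mem_filter]; exact ⟨Finset.mem_univ _, hs'⟩, z,
    by rw [Finset.mem_filter]; exact ⟨Finset.mem_univ _, hz⟩, hzc⟩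

end Bound

end Current

end Literature.Probability.LatticeModels
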